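import Summits.ValiantsHypothesis.ValiantsHypothesis.Theorems.GrenetZeonDualUnipotentThreeHalvesHeavyTopThreeFour
import Summits.ValiantsHypothesis.ValiantsHypothesis.Theorems.DualUnipotentThreeHalves.Negative.FlagCheapOfTriangularisable

/-!
# `GrenetZeon.DualUnipotentThreeHalves` (stmt-ValiantsHypothesis-24318), R2 `HeavyTopLaw` — the GRADED-FLAG
# CERTIFICATE for the finite instances `HeavyTopInst n m` (instrument, director-valiant R259 (a); rung currency only)

The instance table `Cruxes/DualUnipotentThreeHalves/INSTANCES.md` (val-port-3 g2) decides formats `(n, m)` of R2 by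
ONE certificate, made kernel-exact here:

* `flagCheap_of_triangularisable_levels` — **Lemma D with EXACT pair count and ARBITRARY block shape**
  (✓ `…Negative.FlagCost.flagCheap_of_triangularisable_blocks` is the equal-blocks form with the crude count
  `m(h−1)`): if a constant `P` makes `P·N·P⁻¹` strictly upper triangular and `lvl : Fin m → ℕ` is an antitone
  level function with `p` levels, then `K := {v : P N_lin(v) P⁻¹ vanishes on the pairs i < j of equal level}`
  and the constant flag give `FlagCheap n m N` as soon as
  `p·n + #{i < j : lvl i = lvl j} < n²`.  For consecutive blocks of sizes `(m_1,…,m_p)` the pair count is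
  `Σ C(m_t, 2)`, so the format number of the table is `f(m,n) = min_p [p·n + min Σ C(m_t,2)]`.
* `exists_strictUpper_conj_of_finrank_top_eq_choose_two` — **top slice**: if the top space
  `N_lin(ℂ^{n×n})` of an affine NILPOTENT pencil has the Gerstenhaber-maximal dimension `C(m,2)`, then
  `ℂ·N(0) + N_lin(ℂ^{n×n})` is a nilpotent linear space of that dimension, hence (✓
  `Literature…deSeguinsPazzis2013_equality_holds`, every `m`, in the tree) conjugate to `NT_m`: ONE constant `P`
  triangularises the whole pencil, as a polynomial identity.
* Instances BY THE ROUTE: `flagCheap_four_six_of_top_eq` (format `(4,6)`, top slice `d = 15`, flag `(3,3)`: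
  `2·4 + 3 + 3 = 14 < 16`), `flagCheap_five_seven_of_top_eq` (`(5,7)`, `d = 21`, flag `(4,3)`: `19 < 25`),
  `flagCheap_six_nine_of_top_eq` (`(6,9)`, `d = 36`, flag `(3,3,3)`: `27 < 36`), UNCONDITIONAL; and
  `heavyTopInst_of_triangularisable_threshold` with its corollaries `heavyTopInst_four_six_of_nearMaximal`,
  `…five_seven…`, `…six_nine…` — the WHOLE formats `(4,6)`, `(5,7)`, `(6,9)` GIVEN the explicit hypothesis that
  nilpotent subspaces of `M_m(ℂ)` of dimension `≥ 12`, `≥ 20`, `≥ 30` respectively are simultaneously triangularisable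
  (the near-maximal structure statement the table calls F(m, d₀); `d₀ > C(m−1,2) + 1` in all three; NOT asserted
  here — a hypothesis, to be replaced by a Literature fact once located).

Honest framing: instances / conditional instances of the LAW R2; nothing here proves or refutes `HeavyTopLaw`,
24318, S3b or 8062; `VP ≠ VNP` is not moved; no summit statement is proved here.  No definitions, no named facts.
[folklore + Gerstenhaber 1958 / de Seguins Pazzis 2013 Thm 1 via the tree]
-/

noncomputable section

-- single-conjunct layout: Sub = Summit, duplicated namespace component intended
set_option linter.dupNamespace false

namespace Summit.ValiantsHypothesis.ValiantsHypothesis.Theorems.GrenetZeon.HeavyTopGradedFlag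

open MvPolynomial Matrix
open scoped BigOperators
open Summit.ValiantsHypothesis.ValiantsHypothesis.Cruxes.TwoDimCoefficients.DimTwoCases (AffMat IsAffine)
open Summit.ValiantsHypothesis.ValiantsHypothesis.Theorems.GrenetZeon.RadicalSplit
open Summit.ValiantsHypothesis.ValiantsHypothesis.Theorems.DualUnipotentThreeHalvesNegative.FlagCost
  (coeff_aeval_line_eq_zero_of_two_le map_conj_algHom coeff_conj_apply top_map_aeval_line_eq_linPart)
open Literature.LinearAlgebra.Matrix.GerstenhaberNilpotentSubspace
  (finrank_le_choose_two deSeguinsPazzis2013_equality_holds)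

/-! ## §1 Lemma D with exact pair count and arbitrary levels -/

/-- **Triangularisable pencils are flag-cheap below the exact budget.**  Let the entrywise-affine pencil `N` be
strictly upper triangular after a constant change of basis `P`, and let `lvl : Fin m → ℕ` be antitone in the
index with `p` levels.  If `p·n + #{(i,j) : i < j, lvl i = lvl j} < n²` then `FlagCheap n m N`: take
`K = {v : the conjugated linear part vanishes on equal-level pairs}`, budget `k = p − 1`, and on every line the
constant flag `g = P`, `r = a = 0`.  (✓ `flagCheap_of_triangularisable_blocks` is the case `lvl i = (m−1−i)/h`
with the count bounded by `m(h−1)`.) [folklore] -/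
theorem flagCheap_of_triangularisable_levels {n m : ℕ} (N : AffMat n m) (hN : IsAffine N)
    (P : (Matrix (Fin m) (Fin m) ℂ)ˣ)
    (htri : ∀ i j : Fin m, j ≤ i →
      ((P : Matrix (Fin m) (Fin m) ℂ).map C * N * (↑P⁻¹ : Matrix (Fin m) (Fin m) ℂ).map C :
        Matrix (Fin m) (Fin m) (MvPolynomial (Fin n × Fin n) ℂ)) i j = 0)
    (lvl : Fin m → ℕ) (hanti : ∀ i j : Fin m, i < j → lvl j ≤ lvl i) (p : ℕ) (hp : 1 ≤ p)
    (hlvl : ∀ i, lvl i < p)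
    (hbudget : p * n + Fintype.card {q : Fin m × Fin m // q.1 < q.2 ∧ lvl q.1 = lvl q.2} < n ^ 2) :
    FlagCheap n m N := by
  classical
  -- the conjugated linear part, as a linear map
  obtain ⟨f, hf⟩ : ∃ f : (Fin n × Fin n → ℂ) → Matrix (Fin m) (Fin m) ℂ, ∀ v,
      f v = (P : Matrix (Fin m) (Fin m) ℂ) *
        Matrix.of (fun i j => ∑ c, v c * coeff (Finsupp.single c 1) (N i j)) * (↑P⁻¹ : Matrix (Fin m) (Fin m) ℂ) :=
    ⟨_, fun _ => rfl⟩
  have hflin : IsLinearMap ℂ f := by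
    constructor
    · intro v w
      have e : (Matrix.of fun i j => ∑ c, (v + w) c * coeff (Finsupp.single c 1) (N i j)) =
          (Matrix.of fun i j => ∑ c, v c * coeff (Finsupp.single c 1) (N i j)) +
          Matrix.of fun i j => ∑ c, w c * coeff (Finsupp.single c 1) (N i j) := by
        ext i j; simp [Matrix.add_apply, add_mul, Finset.sum_add_distrib]
      rw [hf, hf, hf, e, Matrix.mul_add, Matrix.add_mul]
    · intro a v
      have e : (Matrix.of fun i j => ∑ c, (a • v) c * coeff (Finsupp.single c 1) (N i j)) =
          a • Matrix.of fun i j => ∑ c, v c * coeff (Finsupp.single c 1) (N i j) := by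
        ext i j; simp [Matrix.smul_apply, Finset.mul_sum, mul_assoc]
      rw [hf, hf, e, Matrix.mul_smul, Matrix.smul_mul]
  obtain ⟨T, hT⟩ : ∃ T : (Fin n × Fin n → ℂ) →ₗ[ℂ] Matrix (Fin m) (Fin m) ℂ, ∀ v,
      T v = (P : Matrix (Fin m) (Fin m) ℂ) *
        Matrix.of (fun i j => ∑ c, v c * coeff (Finsupp.single c 1) (N i j)) * (↑P⁻¹ : Matrix (Fin m) (Fin m) ℂ) :=
    ⟨IsLinearMap.mk' f hflin, fun v => by rw [IsLinearMap.mk'_apply, hf]⟩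
  -- the equal-level entries of the conjugated linear part, as a linear map to coordinates
  obtain ⟨l, hl⟩ : ∃ l : (Fin n × Fin n → ℂ) → ({q : Fin m × Fin m // q.1 < q.2 ∧ lvl q.1 = lvl q.2} → ℂ),
      ∀ v q, l v q = T v q.1.1 q.1.2 := ⟨fun v q => T v q.1.1 q.1.2, fun _ _ => rfl⟩
  have hllin : IsLinearMap ℂ l := by
    constructor
    · intro v w; funext q; rw [Pi.add_apply, hl, hl, hl, map_add, Matrix.add_apply]
    · intro a v; funext q; rw [Pi.smul_apply, hl, hl, map_smul, Matrix.smul_apply, smul_eq_mul]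
  obtain ⟨L, hL⟩ : ∃ L : (Fin n × Fin n → ℂ) →ₗ[ℂ]
      ({q : Fin m × Fin m // q.1 < q.2 ∧ lvl q.1 = lvl q.2} → ℂ), ∀ v q, L v q = T v q.1.1 q.1.2 :=
    ⟨IsLinearMap.mk' l hllin, fun v q => by rw [IsLinearMap.mk'_apply, hl]⟩
  refine ⟨LinearMap.ker L, p - 1, fun x v hv => ⟨P, lvl, p, 0, 0, hlvl, ?_, ?_⟩, ?_⟩
  · -- the budget of the flag is p − 1
    simp [flagDeg]
  · -- adaptedness
    intro i j d hd
    set φ : MvPolynomial (Fin n × Fin n) ℂ →ₐ[ℂ] MvPolynomial (Fin 1) ℂ :=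
      aeval fun c => (C (x c) + ∑ t : Fin 1, C (v c) * X t : MvPolynomial (Fin 1) ℂ) with hφ
    have hφ' : lineSubst x v = φ := rfl
    rw [hφ'] at hd
    have hij : i < j := by
      rcases lt_or_ge i j with hlt' | hle
      · exact hlt'
      · exfalso
        apply hd
        rw [← map_conj_algHom φ, Matrix.map_apply, htri i j hle, map_zero, coeff_zero]
    have hcoeff := coeff_conj_apply (P : Matrix (Fin m) (Fin m) ℂ) (↑P⁻¹ : Matrix (Fin m) (Fin m) ℂ)
      (N.map φ) d i j
    have hji := hanti i j hij
    rcases Nat.lt_or_ge (d 0) 2 with hlt | hge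
    · rcases Nat.lt_or_ge (d 0) 1 with h0 | h1
      · have hd0 : d 0 = 0 := by omega
        rw [hd0, mul_zero, zero_add, add_zero]
        exact hji
      · have hd1 : d 0 = 1 := by omega
        have hdeq : d = Finsupp.single 0 1 := Finsupp.ext fun t => by
          fin_cases t; simp [hd1]
        have htop : coeff d (((P : Matrix (Fin m) (Fin m) ℂ).map C * N.map φ *
            (↑P⁻¹ : Matrix (Fin m) (Fin m) ℂ).map C : Matrix (Fin m) (Fin m) (MvPolynomial (Fin 1) ℂ)) i j) =
            T v i j := by
          rw [hcoeff, hdeq, hφ, top_map_aeval_line_eq_linPart N hN x v, hT]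
        have hne : lvl i ≠ lvl j := by
          intro he
          have h0 := congr_fun (LinearMap.mem_ker.mp hv) ⟨(i, j), hij, he⟩
          rw [hL, Pi.zero_apply] at h0
          exact hd (htop.trans h0)
        have hlt' : lvl j < lvl i := lt_of_le_of_ne hji (Ne.symm hne)
        rw [hd1]; omega
    · exfalso
      apply hd
      rw [hcoeff]
      have hz : (N.map φ).map (coeff d) = 0 := by
        ext a b
        simp only [Matrix.map_apply, Matrix.zero_apply]
        exact coeff_aeval_line_eq_zero_of_two_le _ (hN a b) x v d hge
      rw [hz, Matrix.mul_zero, Matrix.zero_mul, Matrix.zero_apply]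
  · -- dimension count: dim K ≥ n² − #pairs > p·n = (k+1)·n
    have h1 := LinearMap.finrank_range_add_finrank_ker L
    have h2 : Module.finrank ℂ (LinearMap.range L) ≤
        Fintype.card {q : Fin m × Fin m // q.1 < q.2 ∧ lvl q.1 = lvl q.2} := by
      have := Submodule.finrank_le (LinearMap.range L)
      rwa [Module.finrank_fintype_fun_eq_card] at this
    have h3 : Module.finrank ℂ (Fin n × Fin n → ℂ) = n * n := by
      rw [Module.finrank_fintype_fun_eq_card, Fintype.card_prod, Fintype.card_fin]
    have h4 : n ^ 2 = n * n := sq n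
    have h5 : p - 1 + 1 = p := Nat.sub_add_cancel hp
    rw [h5]
    omega

/-! ## §2 The top slice: `dim N_lin(ℂ^{n×n}) = C(m,2)` triangularises the whole pencil -/

/-- The linear space `ℂ·N(0) + N_lin(ℂ^{n×n})` of an affine nilpotent pencil consists of nilpotent matrices
(`s·N(0) + N_lin(v) = s·N(s⁻¹ v)` for `s ≠ 0`; `N_lin(v)` is nilpotent by ✓ `linPart_pow_eq_zero`). [folklore] -/
theorem isNilpotent_of_mem_span_sup_range {n m : ℕ} (N : AffMat n m) (hN : IsAffine N) (hnil : N ^ m = 0)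
    (T : (Fin n × Fin n → ℂ) →ₗ[ℂ] Matrix (Fin m) (Fin m) ℂ) (hT : ∀ v, T v = linPart N v)
    (M : Matrix (Fin m) (Fin m) ℂ)
    (hM : M ∈ (ℂ ∙ N.map (MvPolynomial.eval 0)) ⊔ LinearMap.range T) : IsNilpotent M := by
  obtain ⟨y, hy, z, hz, rfl⟩ := Submodule.mem_sup.1 hM
  obtain ⟨s, rfl⟩ := Submodule.mem_span_singleton.1 hy
  obtain ⟨v, rfl⟩ := LinearMap.mem_range.1 hz
  by_cases hs : s = 0
  · rw [hs, zero_smul, zero_add, hT]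
    exact ⟨m, linPart_pow_eq_zero N hN hnil v⟩
  · have h : s • N.map (MvPolynomial.eval 0) + T v = s • N.map (MvPolynomial.eval (s⁻¹ • v)) := by
      have h1 : N.map (MvPolynomial.eval (s⁻¹ • v)) = N.map (MvPolynomial.eval 0) + T (s⁻¹ • v) := by
        rw [hT]; unfold linPart; abel
      rw [h1, smul_add, map_smul, smul_smul, mul_inv_cancel₀ hs, one_smul]
    rw [h]
    exact ⟨m, by rw [smul_pow, map_eval_pow_eq_zero N hnil, smul_zero]⟩

/-- **A triangularising matrix for `ℂ·N(0) + N_lin` triangularises the pencil as a POLYNOMIAL matrix.**  If an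
invertible `P` makes every member of `ℂ·N(0) + N_lin(ℂ^{n×n})` strictly upper triangular, then every value
`P·N(x)·P⁻¹` is strictly upper triangular, hence so is `P·N·P⁻¹` entrywise as a polynomial (`MvPolynomial.funext`).
[folklore] -/
theorem exists_strictUpper_conj_of_forall_mem {n m : ℕ} (N : AffMat n m)
    (T : (Fin n × Fin n → ℂ) →ₗ[ℂ] Matrix (Fin m) (Fin m) ℂ) (hT : ∀ v, T v = linPart N v)
    (P : Matrix (Fin m) (Fin m) ℂ) (hP : IsUnit P)
    (hPW : ∀ A ∈ (ℂ ∙ N.map (MvPolynomial.eval 0)) ⊔ LinearMap.range T,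
      Literature.LinearAlgebra.Matrix.IsStrictUpper (P * A * P⁻¹)) :
    ∃ u : (Matrix (Fin m) (Fin m) ℂ)ˣ, ∀ i j : Fin m, j ≤ i →
      ((u : Matrix (Fin m) (Fin m) ℂ).map C * N * (↑u⁻¹ : Matrix (Fin m) (Fin m) ℂ).map C :
        Matrix (Fin m) (Fin m) (MvPolynomial (Fin n × Fin n) ℂ)) i j = 0 := by
  classical
  obtain ⟨u, hu⟩ : ∃ u : (Matrix (Fin m) (Fin m) ℂ)ˣ, (u : Matrix (Fin m) (Fin m) ℂ) = P := hP
  have hu' : (↑u⁻¹ : Matrix (Fin m) (Fin m) ℂ) = P⁻¹ := by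
    rw [← hu, Matrix.coe_units_inv]
  refine ⟨u, fun i j hji => ?_⟩
  -- every value `N(x)` lies in the space, hence is strictly upper after conjugation
  have hval : ∀ x : Fin n × Fin n → ℂ, (P * N.map (MvPolynomial.eval x) * P⁻¹) i j = 0 := by
    intro x
    have hmem : N.map (MvPolynomial.eval x) ∈ (ℂ ∙ N.map (MvPolynomial.eval 0)) ⊔ LinearMap.range T := by
      have h1 : N.map (MvPolynomial.eval x) = N.map (MvPolynomial.eval 0) + T x := by
        rw [hT]; unfold linPart; abel
      rw [h1]
      exact Submodule.add_mem_sup (Submodule.mem_span_singleton_self _) (LinearMap.mem_range_self T x)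
    exact hPW _ hmem i j hji
  -- polynomial identity from all evaluations
  apply MvPolynomial.funext
  intro x
  rw [map_zero]
  have hev : MvPolynomial.eval x (((u : Matrix (Fin m) (Fin m) ℂ).map C * N * (↑u⁻¹ : Matrix (Fin m) (Fin m) ℂ).map C :
      Matrix (Fin m) (Fin m) (MvPolynomial (Fin n × Fin n) ℂ)) i j) =
      ((((u : Matrix (Fin m) (Fin m) ℂ).map C * N * (↑u⁻¹ : Matrix (Fin m) (Fin m) ℂ).map C).map
        (MvPolynomial.eval x)) i j) := rfl
  rw [hev, Matrix.map_mul, Matrix.map_mul, Matrix.map_map, Matrix.map_map]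
  have hC : ((MvPolynomial.eval x : MvPolynomial (Fin n × Fin n) ℂ → ℂ) ∘ (C : ℂ → MvPolynomial (Fin n × Fin n) ℂ)) = id :=
    funext fun a => by simp
  rw [hC, Matrix.map_id, Matrix.map_id, hu, hu']
  exact hval x

/-- **Top slice ⇒ one constant `P` triangularises the pencil.**  If the top space of an affine nilpotent pencil
has dimension `C(m,2)`, then `ℂ·N(0) + N_lin(ℂ^{n×n})` is a nilpotent linear space of dimension `C(m,2)`
(Gerstenhaber ✓ `finrank_le_choose_two` for `≤`), so by Gerstenhaber's EQUALITY case (✓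
`deSeguinsPazzis2013_equality_holds`) some invertible `P` makes every member strictly upper triangular — and then
`P·N·P⁻¹` is strictly upper triangular as a POLYNOMIAL matrix. [Gerstenhaber 1958 / de Seguins Pazzis 2013 Thm 1,
via the tree] -/
theorem exists_strictUpper_conj_of_finrank_top_eq_choose_two {n m : ℕ} (N : AffMat n m) (hN : IsAffine N)
    (hnil : N ^ m = 0) (T : (Fin n × Fin n → ℂ) →ₗ[ℂ] Matrix (Fin m) (Fin m) ℂ) (hT : ∀ v, T v = linPart N v)
    (hd : Module.finrank ℂ (LinearMap.range T) = m.choose 2) :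
    ∃ P : (Matrix (Fin m) (Fin m) ℂ)ˣ, ∀ i j : Fin m, j ≤ i →
      ((P : Matrix (Fin m) (Fin m) ℂ).map C * N * (↑P⁻¹ : Matrix (Fin m) (Fin m) ℂ).map C :
        Matrix (Fin m) (Fin m) (MvPolynomial (Fin n × Fin n) ℂ)) i j = 0 := by
  classical
  set W : Submodule ℂ (Matrix (Fin m) (Fin m) ℂ) := (ℂ ∙ N.map (MvPolynomial.eval 0)) ⊔ LinearMap.range T
    with hW
  have hWnil : ∀ M ∈ W, IsNilpotent M := fun M hM => isNilpotent_of_mem_span_sup_range N hN hnil T hT M hM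
  have hWdim : Module.finrank ℂ W = m.choose 2 := by
    refine le_antisymm (finrank_le_choose_two m W hWnil) ?_
    rw [← hd]
    exact Submodule.finrank_mono le_sup_right
  obtain ⟨P, hP, hPW⟩ := deSeguinsPazzis2013_equality_holds ℂ m W hWnil hWdim
  exact exists_strictUpper_conj_of_forall_mem N T hT P hP fun A hA => (hPW A).1 hA

/-- **The top slice is flag-cheap below the exact budget**: `dim N_lin(ℂ^{n×n}) = C(m,2)` and a level function
with `p·n + #{equal-level pairs} < n²` give `FlagCheap n m N`. [this file] -/
theorem flagCheap_of_finrank_top_eq_choose_two {n m : ℕ} (N : AffMat n m) (hN : IsAffine N) (hnil : N ^ m = 0)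
    (T : (Fin n × Fin n → ℂ) →ₗ[ℂ] Matrix (Fin m) (Fin m) ℂ) (hT : ∀ v, T v = linPart N v)
    (hd : Module.finrank ℂ (LinearMap.range T) = m.choose 2)
    (lvl : Fin m → ℕ) (hanti : ∀ i j : Fin m, i < j → lvl j ≤ lvl i) (p : ℕ) (hp : 1 ≤ p)
    (hlvl : ∀ i, lvl i < p)
    (hbudget : p * n + Fintype.card {q : Fin m × Fin m // q.1 < q.2 ∧ lvl q.1 = lvl q.2} < n ^ 2) :
    FlagCheap n m N := by
  obtain ⟨P, htri⟩ := exists_strictUpper_conj_of_finrank_top_eq_choose_two N hN hnil T hT hd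
  exact flagCheap_of_triangularisable_levels N hN P htri lvl hanti p hp hlvl hbudget

/-! ## §3 Instances by the route -/

/-- Format `(4, 6)`, two consecutive blocks of size `3`: the equal-level pairs number `C(3,2) + C(3,2) = 6`. -/
theorem card_pairs_six_three :
    Fintype.card {q : Fin 6 × Fin 6 // q.1 < q.2 ∧ (5 - (q.1 : ℕ)) / 3 = (5 - (q.2 : ℕ)) / 3} = 6 := by
  decide

/-- Format `(5, 7)`, consecutive blocks of sizes `(4, 3)`: the equal-level pairs number `C(4,2) + C(3,2) = 9`. -/
theorem card_pairs_seven_four_three :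
    Fintype.card {q : Fin 7 × Fin 7 // q.1 < q.2 ∧
      (if (q.1 : ℕ) < 4 then 1 else 0) = (if (q.2 : ℕ) < 4 then 1 else 0)} = 9 := by
  decide

/-- **Format `(4,6)`, top slice, UNCONDITIONAL**: an affine nilpotent `6 × 6` pencil over `ℂ^{4×4}` whose top space
has the maximal dimension `15 = C(6,2)` is flag-cheap (flag `(3,3)`, budget `1`: `2·4 + 6 = 14 < 16`).
[this file + Gerstenhaber's equality case via the tree] -/
theorem flagCheap_four_six_of_top_eq (N : AffMat 4 6) (hN : IsAffine N) (hnil : N ^ 6 = 0)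
    (T : (Fin 4 × Fin 4 → ℂ) →ₗ[ℂ] Matrix (Fin 6) (Fin 6) ℂ) (hT : ∀ v, T v = linPart N v)
    (hd : Module.finrank ℂ (LinearMap.range T) = 15) : FlagCheap 4 6 N := by
  refine flagCheap_of_finrank_top_eq_choose_two N hN hnil T hT (by rw [hd]; decide)
    (fun i => (5 - (i : ℕ)) / 3) (fun i j hij => Nat.div_le_div_right (by omega)) 2 (by norm_num)
    (fun i => by have := i.isLt; omega) ?_
  rw [card_pairs_six_three]; norm_num

/-- **Format `(5,7)`, top slice, UNCONDITIONAL**: an affine nilpotent `7 × 7` pencil over `ℂ^{5×5}` whose top space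
has the maximal dimension `21 = C(7,2)` is flag-cheap (flag `(4,3)`, budget `1`: `2·5 + 9 = 19 < 25`).
[this file + Gerstenhaber's equality case via the tree] -/
theorem flagCheap_five_seven_of_top_eq (N : AffMat 5 7) (hN : IsAffine N) (hnil : N ^ 7 = 0)
    (T : (Fin 5 × Fin 5 → ℂ) →ₗ[ℂ] Matrix (Fin 7) (Fin 7) ℂ) (hT : ∀ v, T v = linPart N v)
    (hd : Module.finrank ℂ (LinearMap.range T) = 21) : FlagCheap 5 7 N := by
  refine flagCheap_of_finrank_top_eq_choose_two N hN hnil T hT (by rw [hd]; decide)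
    (fun i => if (i : ℕ) < 4 then 1 else 0) (fun i j hij => ?_) 2 (by norm_num)
    (fun i => by split_ifs <;> omega) ?_
  · have h : (i : ℕ) < j := hij
    split_ifs <;> omega
  · rw [card_pairs_seven_four_three]; norm_num

/-- Format `(6, 9)`, three consecutive blocks of size `3`: the equal-level pairs number `3·C(3,2) = 9`. -/
theorem card_pairs_nine_three :
    Fintype.card {q : Fin 9 × Fin 9 // q.1 < q.2 ∧ (8 - (q.1 : ℕ)) / 3 = (8 - (q.2 : ℕ)) / 3} = 9 := by
  decide

/-- **Format `(6,9)`, top slice, UNCONDITIONAL**: an affine nilpotent `9 × 9` pencil over `ℂ^{6×6}` whose top space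
has the maximal dimension `36 = C(9,2)` is flag-cheap (flag `(3,3,3)`, budget `2`: `3·6 + 9 = 27 < 36`).
[this file + Gerstenhaber's equality case via the tree] -/
theorem flagCheap_six_nine_of_top_eq (N : AffMat 6 9) (hN : IsAffine N) (hnil : N ^ 9 = 0)
    (T : (Fin 6 × Fin 6 → ℂ) →ₗ[ℂ] Matrix (Fin 9) (Fin 9) ℂ) (hT : ∀ v, T v = linPart N v)
    (hd : Module.finrank ℂ (LinearMap.range T) = 36) : FlagCheap 6 9 N := by
  refine flagCheap_of_finrank_top_eq_choose_two N hN hnil T hT (by rw [hd]; decide)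
    (fun i => (8 - (i : ℕ)) / 3) (fun i j hij => Nat.div_le_div_right (by omega)) 3 (by norm_num)
    (fun i => by have := i.isLt; omega) ?_
  rw [card_pairs_nine_three]; norm_num

/-! ## §4 Whole formats GIVEN near-maximal triangularisability (explicit hypothesis, not asserted) -/

/-- **`HeavyTopInst n m` from a triangularisability threshold.**  Hypothesis `hF` (explicit, NOT asserted here):
every linear subspace of nilpotent `m × m` complex matrices of dimension `≥ d₀` is strictly upper triangular after
one constant change of basis.  If `d₀ + n ≤ n²` (so that smaller top spaces are handled by the kernel certificate
✓ `flagCheap_of_finrank_range_lt`) and some level function has `p·n + #{equal-level pairs} < n²`, then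
`HeavyTopInst n m` (the heavy-top hypothesis is not used).  For `d₀ > C(m−1,2) + 1` the table
(`Cruxes/DualUnipotentThreeHalves/INSTANCES.md` §5, Q-near) expects `hF` to be a theorem of the literature.
[this file] -/
theorem heavyTopInst_of_triangularisable_threshold {n m d₀ : ℕ} (hd₀ : d₀ + n ≤ n * n)
    (hF : ∀ V : Submodule ℂ (Matrix (Fin m) (Fin m) ℂ), (∀ A ∈ V, IsNilpotent A) → d₀ ≤ Module.finrank ℂ V →
      ∃ P : Matrix (Fin m) (Fin m) ℂ, IsUnit P ∧
        ∀ A ∈ V, Literature.LinearAlgebra.Matrix.IsStrictUpper (P * A * P⁻¹))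
    (lvl : Fin m → ℕ) (hanti : ∀ i j : Fin m, i < j → lvl j ≤ lvl i) (p : ℕ) (hp : 1 ≤ p)
    (hlvl : ∀ i, lvl i < p)
    (hbudget : p * n + Fintype.card {q : Fin m × Fin m // q.1 < q.2 ∧ lvl q.1 = lvl q.2} < n ^ 2) :
    HeavyTopInst n m := by
  classical
  intro N hN hnil _
  obtain ⟨T, hT⟩ := exists_topMap_linPart N hN
  by_cases hlt : Module.finrank ℂ (LinearMap.range T) < d₀
  · exact flagCheap_of_finrank_range_lt N hN T hT (by omega)
  set W : Submodule ℂ (Matrix (Fin m) (Fin m) ℂ) := (ℂ ∙ N.map (MvPolynomial.eval 0)) ⊔ LinearMap.range T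
    with hW
  have hWnil : ∀ M ∈ W, IsNilpotent M := fun M hM => isNilpotent_of_mem_span_sup_range N hN hnil T hT M hM
  have hWd : d₀ ≤ Module.finrank ℂ W :=
    le_trans (by omega) (Submodule.finrank_mono (le_sup_right : LinearMap.range T ≤ W))
  obtain ⟨P, hP, hPW⟩ := hF W hWnil hWd
  obtain ⟨u, htri⟩ := exists_strictUpper_conj_of_forall_mem N T hT P hP hPW
  exact flagCheap_of_triangularisable_levels N hN u htri lvl hanti p hp hlvl hbudget

/-- **`HeavyTopInst 4 6` GIVEN near-maximal triangularisability at `(6, 12)`** (`12 > C(5,2) + 1 = 11`; with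
`d ≤ 11` the kernel works, `11 + 4 < 16`; with `d ≥ 12` the flag `(3,3)` certifies, `2·4 + 6 = 14 < 16`).
Conditional: the hypothesis is explicit and not asserted; it is the LINEAR-SPACE form F(6,12) of the instance
table — the pencil-shaped form is val-port-2 g2's `heavyTopInst_four_six_of_triangularisable_tops`
(`…HeavyTopFourSixTriangularisable`), to which `exists_strictUpper_conj_of_forall_mem` is the bridge. [this file] -/
theorem heavyTopInst_four_six_of_nearMaximal
    (hF : ∀ V : Submodule ℂ (Matrix (Fin 6) (Fin 6) ℂ), (∀ A ∈ V, IsNilpotent A) → 12 ≤ Module.finrank ℂ V →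
      ∃ P : Matrix (Fin 6) (Fin 6) ℂ, IsUnit P ∧
        ∀ A ∈ V, Literature.LinearAlgebra.Matrix.IsStrictUpper (P * A * P⁻¹)) :
    HeavyTopInst 4 6 := by
  refine heavyTopInst_of_triangularisable_threshold (by norm_num) hF
    (fun i => (5 - (i : ℕ)) / 3) (fun i j hij => Nat.div_le_div_right (by omega)) 2 (by norm_num)
    (fun i => by have := i.isLt; omega) ?_
  rw [card_pairs_six_three]; norm_num

/-- **`HeavyTopInst 5 7` GIVEN near-maximal triangularisability at `(7, 20)`** (`20 > C(6,2) + 1 = 16`; kernel for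
`d ≤ 19` since `19 + 5 < 25`; flag `(4,3)` for `d ≥ 20`: `2·5 + 9 = 19 < 25`).  Conditional. [this file] -/
theorem heavyTopInst_five_seven_of_nearMaximal
    (hF : ∀ V : Submodule ℂ (Matrix (Fin 7) (Fin 7) ℂ), (∀ A ∈ V, IsNilpotent A) → 20 ≤ Module.finrank ℂ V →
      ∃ P : Matrix (Fin 7) (Fin 7) ℂ, IsUnit P ∧
        ∀ A ∈ V, Literature.LinearAlgebra.Matrix.IsStrictUpper (P * A * P⁻¹)) :
    HeavyTopInst 5 7 := by
  refine heavyTopInst_of_triangularisable_threshold (by norm_num) hF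
    (fun i => if (i : ℕ) < 4 then 1 else 0) (fun i j hij => ?_) 2 (by norm_num)
    (fun i => by split_ifs <;> omega) ?_
  · have h : (i : ℕ) < j := hij
    split_ifs <;> omega
  · rw [card_pairs_seven_four_three]; norm_num

/-- **`HeavyTopInst 6 9` GIVEN near-maximal triangularisability at `(9, 30)`** (`30 > C(8,2) + 1 = 29`; kernel for
`d ≤ 29` since `29 + 6 < 36`; flag `(3,3,3)` for `d ≥ 30`: `3·6 + 9 = 27 < 36`).  Conditional. [this file] -/
theorem heavyTopInst_six_nine_of_nearMaximal
    (hF : ∀ V : Submodule ℂ (Matrix (Fin 9) (Fin 9) ℂ), (∀ A ∈ V, IsNilpotent A) → 30 ≤ Module.finrank ℂ V →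
      ∃ P : Matrix (Fin 9) (Fin 9) ℂ, IsUnit P ∧
        ∀ A ∈ V, Literature.LinearAlgebra.Matrix.IsStrictUpper (P * A * P⁻¹)) :
    HeavyTopInst 6 9 := by
  refine heavyTopInst_of_triangularisable_threshold (by norm_num) hF
    (fun i => (8 - (i : ℕ)) / 3) (fun i j hij => Nat.div_le_div_right (by omega)) 3 (by norm_num)
    (fun i => by have := i.isLt; omega) ?_
  rw [card_pairs_nine_three]; norm_num

end Summit.ValiantsHypothesis.ValiantsHypothesis.Theorems.GrenetZeon.HeavyTopGradedFlag

end
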